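import Literature.Geometry.Riemannian.RicciFlowMetricFlow
import Literature.Geometry.Riemannian.MetricFlowConcentration
import Literature.Geometry.Riemannian.RicciFlowHeatKernelFn
import Literature.Geometry.Riemannian.VarianceMonotoneOfDistributional
import Literature.Geometry.Riemannian.RicciFlowDistanceContinuity
import Literature.MeasureTheory.Integral.IteratedIntegralWeakLimit
import HarnessLib

/-!
# `H`-concentration of the metric flow of a compact Ricci flow from the distributional
# distance-distortion inequality (Bamler 2020a, Thm. 3.5 ⇒ Cor. 3.6 ⇒ Cor. 3.7; Bamler 2023, §3.7)

R. Bamler, *Entropy and heat kernel bounds on a Ricci flow background*, arXiv:2008.07093 (2020a),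
§3: Thm. 3.5 `(∂ₜ − Δ_x − Δ_y) d_t²(x, y) ≥ −H_n`, Cor. 3.6 (monotonicity of
`Var_t(μ_{1,t}, μ_{2,t}) + H_n t` for conjugate heat flows), Cor. 3.7
(`Var_s(ν_{x₁,t;s}, ν_{x₂,t;s}) ≤ d_t²(x₁, x₂) + H_n (t − s)`), i.e. the metric flow of the Ricci
flow is `H_n`-concentrated (Bamler 2023, §3.7).

This file proves the passage **distributional Thm. 3.5 ⇒ `H`-concentration** for the metric flow
`ricciFlowMetricFlow` of a Ricci flow of Riemannian metrics on a closed connected manifold: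

* `IsRicciFlow.integral_integral_distSq_heatKernelMeasure_le` — for `s < t` in the flow interval,
  `∫∫ d_s²(y₁, y₂) dν_{x₂,t;s}(y₂) dν_{x₁,t;s}(y₁) ≤ d_t²(x₁, x₂) + H (t − s)` (Cor. 3.6 for the two
  heat kernels on `[r₁, r₂] ⊂ (s, t)` — `integral_integral_mul_sub_ge_of_distributional` with the
  kernel densities `heatKernelFn` — then `r₂ ↗ t` (`ν_{xᵢ,t;r} → δ_{xᵢ}` weakly, `d_r² → d_t²`
  uniformly: `tendsto_integral_integral_of_tendsto`) and `r₁ ↘ s`);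
* `isHConcentrated_ricciFlowMetricFlow_of_distributional` — the metric flow is `H`-concentrated
  (`MetricFlow.IsHConcentrated`), converting the real double integral into the `ℝ≥0∞`-valued
  `variance`.

The distributional inequality for `d_t²` is a HYPOTHESIS here (it follows from Bamler's Thm. 3.5);
everything else is proved; no definitions, no named facts.

## References

* R. H. Bamler, *Entropy and heat kernel bounds on a Ricci flow background*, arXiv:2008.07093
  (2020), §3, Thm. 3.5, Cor. 3.6, Cor. 3.7. [Bamler2020Entropy]
* R. H. Bamler, *Compactness theory of the space of super Ricci flows*, Invent. Math. 233 (2023),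
  §3.4 (H-concentration), §3.7. [Bamler2023]
-/

noncomputable section

open Bundle Set Function Filter Manifold MeasureTheory Measure TopologicalSpace
open scoped Manifold ContDiff Topology ENNReal NNReal

namespace Literature.Geometry.Riemannian

open Lorentzian Lorentzian.PseudoRiemannianMetric Literature.MeasureTheory.Integral

universe u

section HConcentration

variable {m : ℕ} {H : Type*} [TopologicalSpace H]
  {I : ModelWithCorners ℝ (EuclideanSpace ℝ (Fin m)) H} [I.Boundaryless]
  {M : Type u} [TopologicalSpace M] [ChartedSpace H M] [IsManifold I ∞ M]
  [T2Space M] [CompactSpace M] [SecondCountableTopology M] [MeasurableSpace M] [BorelSpace M]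
  [ConnectedSpace M]
  {h : ℝ → PseudoRiemannianMetric I ∞ (EuclideanSpace ℝ (Fin m)) (TangentSpace I : M → Type _)}
  (hh : IsContMDiffFamilyOn ∞ h univ) (hR : ∀ r, (h r).IsRiemannian)
  {cov : ℝ → CovariantDerivative I (EuclideanSpace ℝ (Fin m)) (TangentSpace I : M → Type _)}

/-- The distributional form of Bamler's distance-distortion estimate on a time interval `[a, b]`:
for every smooth `φ(x, y, t) ≥ 0` vanishing for `t ∉ (a, b)`,
`−H ∫_{(a,b)} ∫∫ φ dV_t dV_t dt ≤ ∫_{(a,b)} ∫∫ d_t²(x,y) (−∂ₜφ + (R_x+R_y)φ − Δ_xφ − Δ_yφ) dV_t dV_t dt`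
(the formal adjoint of `∂ₜ − Δ_x − Δ_y` for `dV_t(x) dV_t(y) dt`). A PREDICATE (hypothesis of the
results below), not a named fact. [cite: Bamler2020Entropy, §3, Thm. 3.5] -/
def DistSqDistributionalSuperSolutionOn (Hc a b : ℝ) : Prop :=
  ∀ φ : M → M → ℝ → ℝ,
    ContMDiff ((I.prod I).prod 𝓘(ℝ, ℝ)) 𝓘(ℝ, ℝ) ∞ (fun p : (M × M) × ℝ ↦ φ p.1.1 p.1.2 p.2) →
    (∀ x y t, 0 ≤ φ x y t) → (∀ x y, ∀ t ∉ Ioo a b, φ x y t = 0) →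
    -Hc * ∫ t in Ioo a b, ∫ x, ∫ y, φ x y t ∂(h t).riemVolume ∂(h t).riemVolume ≤
      ∫ t in Ioo a b, ∫ x, ∫ y, ((h t).edist (hR t) x y).toReal ^ 2 *
        (-deriv (fun s ↦ φ x y s) t +
          ((h t).scalarCurvatureWith (cov t) x + (h t).scalarCurvatureWith (cov t) y) * φ x y t -
          (h t).laplaceBeltrami (fun x' ↦ φ x' y t) x -
          (h t).laplaceBeltrami (fun y' ↦ φ x y' t) y) ∂(h t).riemVolume ∂(h t).riemVolume

/-- **`∫∫ d_s² dν_{x₂,t;s} dν_{x₁,t;s} ≤ d_t²(x₁, x₂) + H (t − s)`** (Bamler 2020a, Cor. 3.7, from the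
distributional distance-distortion inequality on the sub-intervals of `[s, t]`). For a Ricci flow of
Riemannian metrics on `[s, t]`, `s < t`, on a closed connected manifold.
[cite: Bamler2020Entropy, §3, Cor. 3.7] -/
theorem IsRicciFlow.integral_integral_distSq_heatKernelMeasure_le {s t : ℝ} (hst : s < t)
    (hflow : IsRicciFlow h cov (Icc s t)) {Hc : ℝ}
    (hdist : ∀ a b, s < a → a < b → b < t → DistSqDistributionalSuperSolutionOn (cov := cov) hR Hc a b)
    (x₁ x₂ : M) :
    ∫ y₁, ∫ y₂, ((h s).edist (hR s) y₁ y₂).toReal ^ 2 ∂(heatKernelMeasure hh hR t x₂ s)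
        ∂(heatKernelMeasure hh hR t x₁ s) ≤
      ((h t).edist (hR t) x₁ x₂).toReal ^ 2 + Hc * (t - s) := by
  haveI : ∀ r, IsFiniteMeasure (h r).riemVolume := fun r ↦ ⟨(h r).riemVolume_univ_lt_top⟩
  have ht : t ∈ Ioc s t := ⟨hst, le_rfl⟩
  -- notation
  set u : M → M → ℝ → ℝ := fun y₁ y₂ r ↦ ((h r).edist (hR r) y₁ y₂).toReal ^ 2 with hu
  set ν₁ : ℝ → Measure M := fun r ↦ heatKernelMeasure hh hR t x₁ r with hν₁
  set ν₂ : ℝ → Measure M := fun r ↦ heatKernelMeasure hh hR t x₂ r with hν₂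
  set Fm : ℝ → ℝ := fun r ↦ ∫ y₁, ∫ y₂, u y₁ y₂ r ∂ν₂ r ∂ν₁ r with hFm
  set K : M → M × ℝ → ℝ := fun x p ↦ hflow.heatKernelFn hh hR t x p with hK
  -- continuity of `u` at a fixed time, and of the family
  have huc : ∀ r, Continuous fun q : M × M ↦ u q.1 q.2 r := fun r ↦
    (ENNReal.continuousOn_toReal.comp_continuous (PseudoRiemannianMetric.continuous_edist (hR r))
      fun p ↦ PseudoRiemannianMetric.edist_ne_top (hR r) p.1 p.2).pow 2
  have hu0 : ∀ y₁ y₂ r, 0 ≤ u y₁ y₂ r := fun _ _ _ ↦ sq_nonneg _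
  ----------------------------------------------------------------
  -- Step A: Cor. 3.6 for the kernels on `[r₁, r₂] ⊂ (s, t)`
  ----------------------------------------------------------------
  have hA : ∀ r₁ r₂, s < r₁ → r₁ < r₂ → r₂ < t → -Hc * (r₂ - r₁) ≤ Fm r₂ - Fm r₁ := by
    intro r₁ r₂ hsr₁ h12 hr₂t
    set r₀ : ℝ := (s + r₁) / 2 with hr₀
    set r₃ : ℝ := (r₂ + t) / 2 with hr₃
    have hsr₀ : s < r₀ := by rw [hr₀]; linarith
    have hr₀₁ : r₀ < r₁ := by rw [hr₀]; linarith
    have hr₂₃ : r₂ < r₃ := by rw [hr₃]; linarith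
    have hr₃t : r₃ < t := by rw [hr₃]; linarith
    have hr₀₃ : r₀ < r₃ := by linarith
    have hflow' : IsRicciFlow h cov (Icc r₀ r₃) := hflow.mono (Icc_subset_Icc hsr₀.le hr₃t.le)
    -- the kernels as conjugate heat flows on `[r₀, r₃]`
    have hKconj : ∀ x, IsConjugateHeatSolutionOn h cov (Icc r₀ r₃) fun r y ↦ K x (y, r) := fun x ↦
      isConjugateHeatSolutionOn_of_kernel (hflow.heatKernelFn_contMDiffOn hh hR ht x)
        (fun p hp ↦ hflow.deriv_heatKernelFn_time hh hR ht x hp) hsr₀ hr₀₃ hr₃t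
    have hK0 : ∀ x, ∀ r ∈ Icc r₀ r₃, ∀ y, 0 ≤ K x (y, r) := fun x r hr y ↦
      (hflow.heatKernelFn_pos hh hR ht x ⟨mem_univ _, hsr₀.trans_le hr.1, hr.2.trans_lt hr₃t⟩).le
    -- continuity of `u` on the slab
    have huc' : ContinuousOn (fun p : M × M × ℝ ↦ u p.1 p.2.1 p.2.2) (univ ×ˢ univ ×ˢ Icc r₀ r₃) :=
      (hflow'.continuousOn_edist_toReal_family hr₀₃.le hR).pow 2
    have key := hflow'.integral_integral_mul_sub_ge_of_distributional hr₀₃ hR huc'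
      (hdist r₀ r₃ hsr₀ hr₀₃ hr₃t) (hKconj x₁) (hKconj x₂) (hK0 x₁) (hK0 x₂) hr₀₁ h12 hr₂₃
    -- masses are `1`
    have hm : ∀ x, ∫ y, K x (y, r₃) ∂(h r₃).riemVolume = 1 := fun x ↦
      hflow.integral_heatKernelFn_eq_one hh hR ht x ⟨hsr₀.trans hr₀₃, hr₃t⟩
    simp only [hm, mul_one] at key
    -- the double integrals are `Fm`
    have hF : ∀ r ∈ Ioo s t, ∫ x, ∫ y, u x y r * (K x₁ (x, r) * K x₂ (y, r)) ∂(h r).riemVolume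
        ∂(h r).riemVolume = Fm r := by
      intro r hr
      simp only [hFm, hν₁, hν₂]
      rw [hflow.integral_heatKernelMeasure_eq_integral_mul_heatKernelFn hh hR ht x₁ hr]
      refine integral_congr_ae (Eventually.of_forall fun x ↦ ?_)
      simp only
      rw [hflow.integral_heatKernelMeasure_eq_integral_mul_heatKernelFn hh hR ht x₂ hr,
        ← integral_mul_const]
      refine integral_congr_ae (Eventually.of_forall fun y ↦ ?_)
      simp only [hK]
      ring
    rw [hF r₁ ⟨hsr₁, h12.trans hr₂t⟩, hF r₂ ⟨hsr₁.trans h12, hr₂t⟩] at key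
    linarith
  ----------------------------------------------------------------
  -- Step B: weak continuity of the kernels and uniform continuity of `u`
  ----------------------------------------------------------------
  have hweak : ∀ (x : M) (r₀ : ℝ) (φ : M → ℝ), Continuous φ →
      Tendsto (fun r ↦ ∫ y, φ y ∂(heatKernelMeasure hh hR t x r)) (𝓝 r₀)
        (𝓝 (∫ y, φ y ∂(heatKernelMeasure hh hR t x r₀))) := fun x r₀ φ hφ ↦
    (continuous_integral_heatKernelMeasure_left hh hR t x hφ).tendsto r₀
  have hunif : ∀ r₀ ∈ Icc s t, TendstoUniformly (fun r (q : M × M) ↦ u q.1 q.2 r)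
      (fun q ↦ u q.1 q.2 r₀) (𝓝[Ioo s t] r₀) := by
    intro r₀ hr₀
    have h1 := hflow.tendstoUniformly_edist_toReal_sq hst.le hR hr₀
    rw [Metric.tendstoUniformly_iff] at h1 ⊢
    intro ε hε
    exact (h1 ε hε).filter_mono (nhdsWithin_mono _ Ioo_subset_Icc_self)
  have hlim : ∀ r₀ ∈ Icc s t, Tendsto Fm (𝓝[Ioo s t] r₀) (𝓝 (Fm r₀)) := by
    intro r₀ hr₀
    have := tendsto_integral_integral_of_tendsto (X := M) (l := 𝓝[Ioo s t] r₀) (μ := ν₁) (ν := ν₂)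
      (μ₀ := ν₁ r₀) (ν₀ := ν₂ r₀)
      (fun φ hφ ↦ (hweak x₁ r₀ φ hφ).mono_left nhdsWithin_le_nhds)
      (fun φ hφ ↦ (hweak x₂ r₀ φ hφ).mono_left nhdsWithin_le_nhds)
      (D := fun q : M × M ↦ u q.1 q.2 r₀) (huc r₀) (Di := fun r (q : M × M) ↦ u q.1 q.2 r)
      (fun r ↦ huc r) (hunif r₀ hr₀)
    exact this
  -- the filters at the two ends are nontrivial
  have hcl : closure (Ioo s t) = Icc s t := closure_Ioo hst.ne
  haveI hbt : (𝓝[Ioo s t] t).NeBot := mem_closure_iff_nhdsWithin_neBot.1 (hcl ▸ right_mem_Icc.2 hst.le)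
  haveI hbs : (𝓝[Ioo s t] s).NeBot := mem_closure_iff_nhdsWithin_neBot.1 (hcl ▸ left_mem_Icc.2 hst.le)
  -- `Fm t = d_t²(x₁, x₂)`
  have hFt : Fm t = u x₁ x₂ t := by
    simp only [hFm, hν₁, hν₂, heatKernelMeasure_self, integral_dirac]
  ----------------------------------------------------------------
  -- Step C: `r₂ ↗ t`, then `r₁ ↘ s`
  ----------------------------------------------------------------
  have hC : ∀ r₁ ∈ Ioo s t, Fm r₁ ≤ u x₁ x₂ t + Hc * (t - r₁) := by
    intro r₁ hr₁
    have hg : Tendsto (fun r₂ ↦ Fm r₂ + Hc * (r₂ - r₁)) (𝓝[Ioo s t] t) (𝓝 (Fm t + Hc * (t - r₁))) :=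
      (hlim t ⟨hst.le, le_rfl⟩).add (((continuous_const.mul (continuous_id.sub continuous_const)).tendsto t).mono_left
        nhdsWithin_le_nhds)
    rw [hFt] at hg
    refine ge_of_tendsto hg ?_
    have hev : ∀ᶠ r₂ in 𝓝[Ioo s t] t, r₁ < r₂ :=
      mem_nhdsWithin_of_mem_nhds (Ioi_mem_nhds hr₁.2)
    filter_upwards [hev, self_mem_nhdsWithin] with r₂ h12 hr₂
    have := hA r₁ r₂ hr₁.1 h12 hr₂.2
    linarith
  have hD : Tendsto (fun r₁ ↦ u x₁ x₂ t + Hc * (t - r₁)) (𝓝[Ioo s t] s) (𝓝 (u x₁ x₂ t + Hc * (t - s))) :=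
    ((continuous_const.add (continuous_const.mul (continuous_const.sub continuous_id))).tendsto s).mono_left
      nhdsWithin_le_nhds
  exact le_of_tendsto_of_tendsto (hlim s ⟨le_rfl, hst.le⟩) hD
    (eventually_nhdsWithin_of_forall fun r₁ hr₁ ↦ hC r₁ hr₁)

/-- **The metric flow of a compact Ricci flow is `H`-concentrated, given the distributional
distance-distortion inequality** (Bamler 2020a, Cor. 3.7 ⇒ Bamler 2023, §3.7): if
`DistSqDistributionalSuperSolutionOn H a b` holds on every `[a, b]` in the interior of the flow
interval, then `Var_s(ν_{x₁,t;s}, ν_{x₂,t;s}) ≤ d_t²(x₁, x₂) + H (t − s)` for all `s ≤ t` in `S`.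
[cite: Bamler2020Entropy, §3, Cor. 3.7] -/
theorem isHConcentrated_ricciFlowMetricFlow_of_distributional {S : Set ℝ} (hS : S.OrdConnected)
    (hflow : IsRicciFlow h cov S) {Hc : ℝ}
    (hdist : ∀ a b, a < b → Icc a b ⊆ S → DistSqDistributionalSuperSolutionOn (cov := cov) hR Hc a b) :
    (ricciFlowMetricFlow hh hR hS hflow).IsHConcentrated Hc := by
  intro s t hst x₁ x₂
  -- unfold the metric-flow structure: slices `M`, kernels `ν`, distances `d_{h(·)}`
  change ∫⁻ y₁, ∫⁻ y₂, (h s).edist (hR s) y₁ y₂ ^ 2 ∂(heatKernelMeasure hh hR t x₂ s)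
      ∂(heatKernelMeasure hh hR t x₁ s) ≤
    (h t).edist (hR t) x₁ x₂ ^ 2 + ENNReal.ofReal (Hc * ((t : ℝ) - s))
  have hfin : ∀ (r : ℝ) (y₁ y₂ : M), (h r).edist (hR r) y₁ y₂ ≠ ⊤ := fun r y₁ y₂ ↦
    PseudoRiemannianMetric.edist_ne_top (hR r) y₁ y₂
  have hsq : ∀ (r : ℝ) (y₁ y₂ : M), (h r).edist (hR r) y₁ y₂ ^ 2 =
      ENNReal.ofReal (((h r).edist (hR r) y₁ y₂).toReal ^ 2) := fun r y₁ y₂ ↦ by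
    rw [ENNReal.ofReal_pow ENNReal.toReal_nonneg, ENNReal.ofReal_toReal (hfin r y₁ y₂)]
  rcases eq_or_lt_of_le hst with heq | hlt
  · -- `s = t`: both kernels are Dirac masses
    have hst' : (t : ℝ) ≤ s := heq.ge
    rw [heatKernelMeasure_of_le hh hR hst', heatKernelMeasure_of_le hh hR hst', lintegral_dirac,
      lintegral_dirac]
    have : (s : ℝ) = t := heq
    obtain ⟨s, hs⟩ := s
    obtain ⟨t, ht⟩ := t
    simp only at this
    subst this
    exact le_self_add
  · -- `s < t`
    have hsub : Icc (s : ℝ) t ⊆ S := hS.out s.2 t.2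
    have hflow' : IsRicciFlow h cov (Icc (s : ℝ) t) := hflow.mono hsub
    have key := hflow'.integral_integral_distSq_heatKernelMeasure_le hh hR hlt
      (fun a b hsa hab hbt ↦ hdist a b hab ((Icc_subset_Icc hsa.le hbt.le).trans hsub)) x₁ x₂
    -- convert the real double integral into the `ℝ≥0∞` one
    have huc : Continuous fun q : M × M ↦ ((h s).edist (hR s) q.1 q.2).toReal ^ 2 :=
      (ENNReal.continuousOn_toReal.comp_continuous (PseudoRiemannianMetric.continuous_edist (hR s))
        fun p ↦ hfin s p.1 p.2).pow 2
    have hG : Continuous fun y₁ ↦ ∫ y₂, ((h s).edist (hR s) y₁ y₂).toReal ^ 2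
        ∂(heatKernelMeasure hh hR t x₂ s) :=
      continuous_integral_of_continuous_prod (heatKernelMeasure hh hR t x₂ s) huc
    have hinner : ∀ y₁, ∫⁻ y₂, (h s).edist (hR s) y₁ y₂ ^ 2 ∂(heatKernelMeasure hh hR t x₂ s) =
        ENNReal.ofReal (∫ y₂, ((h s).edist (hR s) y₁ y₂).toReal ^ 2 ∂(heatKernelMeasure hh hR t x₂ s)) := by
      intro y₁
      simp_rw [hsq]
      rw [ofReal_integral_eq_lintegral_ofReal]
      · exact (huc.comp (Continuous.prodMk_right y₁)).integrable_of_hasCompactSupport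
          (HasCompactSupport.of_compactSpace _)
      · exact Eventually.of_forall fun y₂ ↦ sq_nonneg _
    simp_rw [hinner]
    rw [← ofReal_integral_eq_lintegral_ofReal (hG.integrable_of_hasCompactSupport
        (HasCompactSupport.of_compactSpace _)) (Eventually.of_forall fun y₁ ↦
          integral_nonneg fun y₂ ↦ sq_nonneg _)]
    calc ENNReal.ofReal (∫ y₁, ∫ y₂, ((h s).edist (hR s) y₁ y₂).toReal ^ 2
          ∂(heatKernelMeasure hh hR t x₂ s) ∂(heatKernelMeasure hh hR t x₁ s))
        ≤ ENNReal.ofReal (((h t).edist (hR t) x₁ x₂).toReal ^ 2 + Hc * (t - s)) :=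
          ENNReal.ofReal_le_ofReal key
      _ ≤ ENNReal.ofReal (((h t).edist (hR t) x₁ x₂).toReal ^ 2) + ENNReal.ofReal (Hc * (t - s)) :=
          ENNReal.ofReal_add_le
      _ = (h t).edist (hR t) x₁ x₂ ^ 2 + ENNReal.ofReal (Hc * ((t : ℝ) - s)) := by rw [← hsq]

end HConcentration

end Literature.Geometry.Riemannian

end
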